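import Summits.Ventures.LatticeQCDFlow.Exactness.ReversibleComparison
import Summits.Ventures.LatticeQCDFlow.Exactness.Phi4MetropolisPolyObsDCT
import HarnessLib

/-!
# The local arm under two step laws: pointwise domination `ρ₁ ≤ c ρ₂` of the proposal densities orders the autocorrelations of EVERY observable, `τ_int,ρ₂ + ½ ≤ c (τ_int,ρ₁ + ½)`

HONEST FRAMING: exact (Metropolis-corrected) sampling algorithms for lattice gauge theory;
figures of merit are autocorrelation/cost numbers at stated couplings and volumes; no
continuum-physics claim.  (SCALAR calibration rung S0-A: not a gauge result.)

Venture `LatticeQCDFlow` (cell pub-lqcd), topic `Exactness`; FANOUT row 2 (`s0-phi4`, LOCAL arm).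
NEW WORK of the cell: the local-arm instance of the comparison theorem
`Exactness/ReversibleComparison.lean` (Peskun–Tierney / Caracciolo–Pelissetto–Sokal in Abel form,
named only there) for row 2's random-site-scan Metropolis `metroScan J λ ρ` on the polynomial class
`PolyObs` (`Phi4MetropolisPolyObs*`: every even step density with all moments).  Nothing is cited
as a fact.  PESKUN'S OFF-DIAGONAL ORDER in the tree's operator vocabulary is the pointwise
carré-du-champ domination `K[(v − v(x))²](x) ≤ c · K'[(v − v(x))²](x)`; for two step laws of the
SAME Metropolis rule it holds with the constant of the densities, `ρ₁ ≤ c ρ₂`.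

## What is proved

* `RevOp.integrable_carre_mul`, **`RevOp.dirichlet_le_mul_of_carre_le`** (format level, `1 ∈ A`,
  `K 1 = K' 1 = 1`): pointwise carré-du-champ domination ⇒ `𝓔(v) ≤ c 𝓔'(v)` (Peskun's hypothesis
  ⇒ the comparison theorem's hypothesis);
* `metroSite_le_of_stepLaw_le`, `metroScan_le_of_stepLaw_le` — for a NONNEGATIVE `G ∈ PolyObs`
  and `ρ₁ ≤ c ρ₂` pointwise: `M_x^{ρ₁} G ≤ c M_x^{ρ₂} G`, `K_{ρ₁} G ≤ c K_{ρ₂} G` pointwise;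
* **`metroScan_dirichlet_le_of_stepLaw_le`** — `𝓔_{ρ₁}(v) ≤ c 𝓔_{ρ₂}(v)` for every `v ∈ PolyObs`
  (lattice φ⁴, coercive action: every `λ > 0`, real `J`);
* **`metropolisScan_abelSum_le_of_stepLaw_le`** — COMPARISON, ABEL FORM (unconditional), per
  proposal: `Σ_k C_{g,ρ₂}(k) sᵏ ≤ (1 − r + r c) Σ_k C_{g,ρ₁}(k) rᵏ`, `s = r c/(1 − r + r c)`;
* **`metropolisScan_tauInt_add_half_le_of_stepLaw_le`** — under the tree's standing summability
  hypothesis for both chains (`g = f − ⟨f⟩`, `Var f > 0`), in proposal units: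
  **`τ_int,ρ₂(f) + ½ ≤ c · (τ_int,ρ₁(f) + ½)`** for EVERY `f ∈ PolyObs`.

Reading (no numerics implied).  Two uses, both instances of `ρ₁ ≤ c ρ₂`:  (i) MIXTURES — a step
law `ρ = a ρ₁ + (1 − a) ρ_big` ("mostly local, occasionally a long jump") has `a ρ₁ ≤ ρ`, so
`τ_ρ + ½ ≤ (τ_{ρ₁} + ½)/a`: adding rare long proposals can never cost more than the factor `1/a`,
for any observable;  (ii) STEP-SIZE TRADE-OFF — windows `U[−δ, δ] ≤ (δ'/δ) U[−δ', δ']` (`δ ≤ δ'`)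
and Gaussians `N(0, s) ≤ √(s'/s) N(0, s')` (`s ≤ s'`) give `τ_{δ'} + ½ ≤ (δ'/δ)(τ_δ + ½)` and
`τ_{s'} + ½ ≤ √(s'/s)(τ_s + ½)`: enlarging the proposal can slow an observable at most LINEARLY in
the width — the rate actually attained in the rejection-dominated regime (acceptance `∝ 1/δ`),
complementing gen-13's floor `τ_sweep(M) ≥ 2χ/m₂ − ½` on the small-step side (concrete instances:
`Exactness/Phi4MetropolisWindowComparison.lean`).  NOT CLAIMED: per-sweep (thinned) forms (Dirichlet
domination is not inherited by `K^V`); the ordered sweep; any number for any run.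
-/

namespace Summit.Ventures.LatticeQCDFlow.Exactness

open Real MeasureTheory Filter Finset
open Summit.Ventures.LatticeQCDFlow.Scoring

/-! ## §1 Format level: carré-du-champ domination is Dirichlet-form domination -/

namespace RevOp

variable {X : Type*} [MeasurableSpace X] {μ : Measure X} {w : X → ℝ} {A : (X → ℝ) → Prop}
  {K K' : (X → ℝ) → (X → ℝ)}

/-- The carré du champ `x ↦ K[(g − g(x))²](x)` of an admissible `g` (with `g² ∈ A`, `1 ∈ A`,
`K 1 = 1`) is `w`-integrable (it is `K(g²) − 2 g Kg + g²` pointwise). -/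
theorem integrable_carre_mul (hA1 : A (fun _ => (1 : ℝ)))
    (hAi : ∀ ⦃f h : X → ℝ⦄, A f → A h → Integrable (fun x => f x * h x * w x) μ)
    (hAc : ∀ ⦃f h : X → ℝ⦄ (c : ℝ), A f → A h → A (fun x => f x + c * h x))
    (hAK : ∀ ⦃f : X → ℝ⦄, A f → A (K f))
    (hlin : ∀ ⦃f h : X → ℝ⦄ (c : ℝ), A f → A h →
      ∀ x, K (fun s => f s + c * h s) x = K f x + c * K h x)
    (hunit : ∀ x, K (fun _ => (1 : ℝ)) x = 1)
    {g : X → ℝ} (hg : A g) (hg2 : A (fun x => g x ^ 2)) :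
    Integrable (fun x => K (fun y => (g y - g x) ^ 2) x * w x) μ := by
  have e : ∀ x, K (fun y => (g y - g x) ^ 2) x * w x
      = K (fun y => g y ^ 2) x * (1 : ℝ) * w x + (-2) * (g x * K g x * w x) + g x ^ 2 * w x := by
    intro x
    rw [op_sq_dev_eq hA1 hAc hlin hunit hg hg2 x]
    ring
  have i1 : Integrable (fun x => K (fun y => g y ^ 2) x * (1 : ℝ) * w x) μ := hAi (hAK hg2) hA1
  have i2 : Integrable (fun x => (-2) * (g x * K g x * w x)) μ := (hAi hg (hAK hg)).const_mul _
  have i3 : Integrable (fun x => g x ^ 2 * w x) μ := integrable_sq_mul hAi hg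
  exact ((i1.add i2).add i3).congr (Eventually.of_forall fun x => (e x).symm)

/-- **PESKUN'S ORDER IN THE `RevOp` VOCABULARY ⇒ DIRICHLET DOMINATION.**  Two operators `K`, `K'`
on the same class (`1 ∈ A`, `K 1 = K' 1 = 1`, `w ≥ 0`); if the carré du champ of `v ∈ A`
(`v² ∈ A`) under `K` is pointwise at most `c` times that under `K'`,
`K[(v − v(x))²](x) ≤ c · K'[(v − v(x))²](x)`, then `𝓔(v) ≤ c · 𝓔'(v)`. -/
theorem dirichlet_le_mul_of_carre_le (hw0 : ∀ x, 0 ≤ w x) (hA1 : A (fun _ => (1 : ℝ)))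
    (hAi : ∀ ⦃f h : X → ℝ⦄, A f → A h → Integrable (fun x => f x * h x * w x) μ)
    (hAc : ∀ ⦃f h : X → ℝ⦄ (c : ℝ), A f → A h → A (fun x => f x + c * h x))
    (hAK : ∀ ⦃f : X → ℝ⦄, A f → A (K f))
    (hlin : ∀ ⦃f h : X → ℝ⦄ (c : ℝ), A f → A h →
      ∀ x, K (fun s => f s + c * h s) x = K f x + c * K h x)
    (hsymm : ∀ ⦃f h : X → ℝ⦄, A f → A h →
      ∫ x, K f x * h x * w x ∂μ = ∫ x, f x * K h x * w x ∂μ)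
    (hunit : ∀ x, K (fun _ => (1 : ℝ)) x = 1)
    (hAK' : ∀ ⦃f : X → ℝ⦄, A f → A (K' f))
    (hlin' : ∀ ⦃f h : X → ℝ⦄ (c : ℝ), A f → A h →
      ∀ x, K' (fun s => f s + c * h s) x = K' f x + c * K' h x)
    (hsymm' : ∀ ⦃f h : X → ℝ⦄, A f → A h →
      ∫ x, K' f x * h x * w x ∂μ = ∫ x, f x * K' h x * w x ∂μ)
    (hunit' : ∀ x, K' (fun _ => (1 : ℝ)) x = 1)
    {c : ℝ} {v : X → ℝ} (hv : A v) (hv2 : A (fun x => v x ^ 2))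
    (hΓ : ∀ x, K (fun y => (v y - v x) ^ 2) x ≤ c * K' (fun y => (v y - v x) ^ 2) x) :
    (∫ x, v x ^ 2 * w x ∂μ) - ∫ x, v x * K v x * w x ∂μ
      ≤ c * ((∫ x, v x ^ 2 * w x ∂μ) - ∫ x, v x * K' v x * w x ∂μ) := by
  have h1 := two_mul_dirichlet_eq hA1 hAi hAc hAK hlin hsymm hunit hv hv2
  have h2 := two_mul_dirichlet_eq hA1 hAi hAc hAK' hlin' hsymm' hunit' hv hv2
  have i1 := integrable_carre_mul hA1 hAi hAc hAK hlin hunit hv hv2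
  have i2 := integrable_carre_mul hA1 hAi hAc hAK' hlin' hunit' hv hv2
  have hmono : ∫ x, K (fun y => (v y - v x) ^ 2) x * w x ∂μ
      ≤ ∫ x, c * (K' (fun y => (v y - v x) ^ 2) x * w x) ∂μ := by
    refine integral_mono i1 (i2.const_mul c) fun x => ?_
    show K (fun y => (v y - v x) ^ 2) x * w x ≤ c * (K' (fun y => (v y - v x) ^ 2) x * w x)
    calc K (fun y => (v y - v x) ^ 2) x * w x ≤ (c * K' (fun y => (v y - v x) ^ 2) x) * w x :=
          mul_le_mul_of_nonneg_right (hΓ x) (hw0 x)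
      _ = c * (K' (fun y => (v y - v x) ^ 2) x * w x) := by ring
  rw [integral_const_mul, ← h1, ← h2] at hmono
  linarith

end RevOp

/-! ## §2 The local arm: step-law domination -/

section Lattice

variable {n : ℕ}

/-- `f − c ∈ PolyObs` (local copy of `polyObs_sub_const` from `Phi4HMCPolyObsFloor`). -/
private theorem polyObs_sub_const' {f : (Fin (n + 1) → ℝ) → ℝ} (hf : PolyObs f) (c : ℝ) :
    PolyObs (fun φ => f φ - c) := by
  have h := polyObs_add_mul hf (polyObs_const 1) (-c)
  have e : (fun φ => f φ + -c * (1 : ℝ)) = fun φ => f φ - c := funext fun φ => by ring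
  rw [e] at h
  exact h

/-- **One site**: for a nonnegative `G ∈ PolyObs` and step laws `ρ₁ ≤ c ρ₂` (pointwise, `c ≥ 0`,
both with all moments): `M_x^{ρ₁} G (φ) ≤ c · M_x^{ρ₂} G (φ)`. -/
theorem metroSite_le_of_stepLaw_le (J : Fin (n + 1) → Fin (n + 1) → ℝ) (lam : ℝ)
    {ρ₁ ρ₂ : ℝ → ℝ} (hρ₁0 : ∀ u, 0 ≤ ρ₁ u) (hρ₁m : Measurable ρ₁)
    (hρ₁mom : ∀ j : ℕ, Integrable (fun u => (1 + |u|) ^ j * ρ₁ u))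
    (hρ₂0 : ∀ u, 0 ≤ ρ₂ u) (hρ₂m : Measurable ρ₂)
    (hρ₂mom : ∀ j : ℕ, Integrable (fun u => (1 + |u|) ^ j * ρ₂ u))
    {c : ℝ} (hdom : ∀ u, ρ₁ u ≤ c * ρ₂ u) (x : Fin (n + 1))
    {G : (Fin (n + 1) → ℝ) → ℝ} (hG : PolyObs G) (hG0 : ∀ ψ, 0 ≤ G ψ) (φ : Fin (n + 1) → ℝ) :
    metroSite J lam ρ₁ x G φ ≤ c * metroSite J lam ρ₂ x G φ := by
  obtain ⟨hGm, B, k, hGb⟩ := hG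
  have hI1 := (integrable_metroSite_integrand_poly J lam hρ₁0 hρ₁m (hρ₁mom (2 * k)) x hGm
    (abs_nonneg B) (abs_le_abs_mul_env hGb) φ).1
  have hI2 := (integrable_metroSite_integrand_poly J lam hρ₂0 hρ₂m (hρ₂mom (2 * k)) x hGm
    (abs_nonneg B) (abs_le_abs_mul_env hGb) φ).1
  unfold metroSite
  rw [← integral_const_mul]
  refine integral_mono hI1 (hI2.const_mul c) fun t' => ?_
  obtain ⟨ha0, ha1⟩ := metroAccept_nonneg_le J lam x φ t'
  have hF : 0 ≤ metroAccept J lam x φ t' * G (Function.update φ x t')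
      + (1 - metroAccept J lam x φ t') * G φ :=
    add_nonneg (mul_nonneg ha0 (hG0 _)) (mul_nonneg (sub_nonneg.2 ha1) (hG0 _))
  show (metroAccept J lam x φ t' * G (Function.update φ x t')
      + (1 - metroAccept J lam x φ t') * G φ) * ρ₁ (t' - φ x)
    ≤ c * ((metroAccept J lam x φ t' * G (Function.update φ x t')
      + (1 - metroAccept J lam x φ t') * G φ) * ρ₂ (t' - φ x))
  calc _ ≤ (metroAccept J lam x φ t' * G (Function.update φ x t')
        + (1 - metroAccept J lam x φ t') * G φ) * (c * ρ₂ (t' - φ x)) :=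
        mul_le_mul_of_nonneg_left (hdom _) hF
    _ = _ := by ring

/-- **The scan**: `K_{ρ₁} G (φ) ≤ c · K_{ρ₂} G (φ)` for nonnegative `G ∈ PolyObs`, `ρ₁ ≤ c ρ₂`. -/
theorem metroScan_le_of_stepLaw_le (J : Fin (n + 1) → Fin (n + 1) → ℝ) (lam : ℝ)
    {ρ₁ ρ₂ : ℝ → ℝ} (hρ₁0 : ∀ u, 0 ≤ ρ₁ u) (hρ₁m : Measurable ρ₁)
    (hρ₁mom : ∀ j : ℕ, Integrable (fun u => (1 + |u|) ^ j * ρ₁ u))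
    (hρ₂0 : ∀ u, 0 ≤ ρ₂ u) (hρ₂m : Measurable ρ₂)
    (hρ₂mom : ∀ j : ℕ, Integrable (fun u => (1 + |u|) ^ j * ρ₂ u))
    {c : ℝ} (hdom : ∀ u, ρ₁ u ≤ c * ρ₂ u)
    {G : (Fin (n + 1) → ℝ) → ℝ} (hG : PolyObs G) (hG0 : ∀ ψ, 0 ≤ G ψ) (φ : Fin (n + 1) → ℝ) :
    metroScan J lam ρ₁ G φ ≤ c * metroScan J lam ρ₂ G φ := by
  have hn : (0 : ℝ) < (n : ℝ) + 1 := by positivity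
  unfold metroScan
  rw [mul_div_assoc', Finset.mul_sum]
  exact div_le_div_of_nonneg_right (Finset.sum_le_sum fun x _ =>
    metroSite_le_of_stepLaw_le J lam hρ₁0 hρ₁m hρ₁mom hρ₂0 hρ₂m hρ₂mom hdom x hG hG0 φ) hn.le

/-- **DIRICHLET DOMINATION FOR TWO STEP LAWS.**  Lattice φ⁴ with a coercive action; two even
probability densities `ρ₁`, `ρ₂` with all moments and `ρ₁ ≤ c ρ₂` pointwise.  Then for every
`v ∈ PolyObs`:  `𝓔_{ρ₁}(v) ≤ c · 𝓔_{ρ₂}(v)`  (`𝓔_ρ(v) = ∫ v² e^{−S} − ∫ v (K_ρ v) e^{−S}`). -/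
theorem metroScan_dirichlet_le_of_stepLaw_le {J : Fin (n + 1) → Fin (n + 1) → ℝ} {lam ε K : ℝ}
    (hε : 0 < ε) (hS : ∀ φ : Fin (n + 1) → ℝ, ε * ∑ w, φ w ^ 2 - K ≤ latticePhi4Action J lam φ)
    {ρ₁ ρ₂ : ℝ → ℝ} (hρ₁0 : ∀ u, 0 ≤ ρ₁ u) (hρ₁m : Measurable ρ₁) (hρ₁i : Integrable ρ₁)
    (hρ₁1 : ∫ u, ρ₁ u = 1) (hρ₁s : ∀ u, ρ₁ (-u) = ρ₁ u)
    (hρ₁mom : ∀ j : ℕ, Integrable (fun u => (1 + |u|) ^ j * ρ₁ u))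
    (hρ₂0 : ∀ u, 0 ≤ ρ₂ u) (hρ₂m : Measurable ρ₂) (hρ₂i : Integrable ρ₂)
    (hρ₂1 : ∫ u, ρ₂ u = 1) (hρ₂s : ∀ u, ρ₂ (-u) = ρ₂ u)
    (hρ₂mom : ∀ j : ℕ, Integrable (fun u => (1 + |u|) ^ j * ρ₂ u))
    {c : ℝ} (hdom : ∀ u, ρ₁ u ≤ c * ρ₂ u)
    {v : (Fin (n + 1) → ℝ) → ℝ} (hv : PolyObs v) :
    (∫ φ, v φ ^ 2 * gibbsWeight J lam φ) - ∫ φ, v φ * metroScan J lam ρ₁ v φ * gibbsWeight J lam φ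
      ≤ c * ((∫ φ, v φ ^ 2 * gibbsWeight J lam φ)
          - ∫ φ, v φ * metroScan J lam ρ₂ v φ * gibbsWeight J lam φ) := by
  exact RevOp.dirichlet_le_mul_of_carre_le (μ := volume) (A := PolyObs)
    (K := metroScan J lam ρ₁) (K' := metroScan J lam ρ₂) (w := gibbsWeight J lam)
    (fun φ => (gibbsWeight_pos J lam φ).le) (polyObs_const 1)
    (fun f h hf hh => polyObs_integrable_mul_mul_gibbsWeight hε hS hf hh)
    (fun f h c hf hh => polyObs_add_mul hf hh c)
    (fun f hf => polyObs_metroScan J lam hρ₁0 hρ₁m hρ₁mom hf)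
    (fun f h c hf hh x => metroScan_add_mul_poly J lam hρ₁0 hρ₁m hρ₁mom hf hh c x)
    (fun f h hf hh => metroScan_reversible_poly hε hS hρ₁0 hρ₁m hρ₁i hρ₁1 hρ₁s hρ₁mom hf hh)
    (fun φ => metroScan_one J lam hρ₁1 φ)
    (fun f hf => polyObs_metroScan J lam hρ₂0 hρ₂m hρ₂mom hf)
    (fun f h c hf hh x => metroScan_add_mul_poly J lam hρ₂0 hρ₂m hρ₂mom hf hh c x)
    (fun f h hf hh => metroScan_reversible_poly hε hS hρ₂0 hρ₂m hρ₂i hρ₂1 hρ₂s hρ₂mom hf hh)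
    (fun φ => metroScan_one J lam hρ₂1 φ)
    hv (polyObs_sq hv)
    (fun φ => metroScan_le_of_stepLaw_le J lam hρ₁0 hρ₁m hρ₁mom hρ₂0 hρ₂m hρ₂mom hdom
      (polyObs_sq (polyObs_sub_const' hv (v φ))) (fun ψ => sq_nonneg _) φ)

/-- **COMPARISON OF TWO STEP LAWS, ABEL FORM (unconditional), per proposal.**  With `ρ₁ ≤ c ρ₂`
(`c > 0`), for every `g ∈ PolyObs`, `0 ≤ r < 1` and `s = r c/(1 − r + r c)`:
`Σ_k C_{g,ρ₂}(k) sᵏ ≤ (1 − r + r c) · Σ_k C_{g,ρ₁}(k) rᵏ`  (`C_{g,ρ}(k) = ∫ g (K_ρᵏ g) e^{−S}`). -/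
theorem metropolisScan_abelSum_le_of_stepLaw_le {J : Fin (n + 1) → Fin (n + 1) → ℝ} {lam ε K : ℝ}
    (hε : 0 < ε) (hS : ∀ φ : Fin (n + 1) → ℝ, ε * ∑ w, φ w ^ 2 - K ≤ latticePhi4Action J lam φ)
    {ρ₁ ρ₂ : ℝ → ℝ} (hρ₁0 : ∀ u, 0 ≤ ρ₁ u) (hρ₁m : Measurable ρ₁) (hρ₁i : Integrable ρ₁)
    (hρ₁1 : ∫ u, ρ₁ u = 1) (hρ₁s : ∀ u, ρ₁ (-u) = ρ₁ u)
    (hρ₁mom : ∀ j : ℕ, Integrable (fun u => (1 + |u|) ^ j * ρ₁ u))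
    (hρ₂0 : ∀ u, 0 ≤ ρ₂ u) (hρ₂m : Measurable ρ₂) (hρ₂i : Integrable ρ₂)
    (hρ₂1 : ∫ u, ρ₂ u = 1) (hρ₂s : ∀ u, ρ₂ (-u) = ρ₂ u)
    (hρ₂mom : ∀ j : ℕ, Integrable (fun u => (1 + |u|) ^ j * ρ₂ u))
    {c : ℝ} (hc : 0 < c) (hdom : ∀ u, ρ₁ u ≤ c * ρ₂ u)
    {g : (Fin (n + 1) → ℝ) → ℝ} (hg : PolyObs g) {r : ℝ} (hr0 : 0 ≤ r) (hr1 : r < 1) :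
    ∑' k, (∫ φ, g φ * ((metroScan J lam ρ₂)^[k] g) φ * gibbsWeight J lam φ)
        * (r * c / (1 - r + r * c)) ^ k
      ≤ (1 - r + r * c)
        * ∑' k, (∫ φ, g φ * ((metroScan J lam ρ₁)^[k] g) φ * gibbsWeight J lam φ) * r ^ k := by
  exact RevOp.abelSum_le_of_dirichlet_le_mul (μ := volume) (A := PolyObs)
    (K := metroScan J lam ρ₁) (K' := metroScan J lam ρ₂) (w := gibbsWeight J lam)
    (fun φ => (gibbsWeight_pos J lam φ).le)
    (fun f h hf hh => polyObs_integrable_mul_mul_gibbsWeight hε hS hf hh)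
    (fun f h c hf hh => polyObs_add_mul hf hh c)
    (fun f hf => polyObs_metroScan J lam hρ₁0 hρ₁m hρ₁mom hf)
    (fun f h c hf hh x => metroScan_add_mul_poly J lam hρ₁0 hρ₁m hρ₁mom hf hh c x)
    (fun f h hf hh => metroScan_reversible_poly hε hS hρ₁0 hρ₁m hρ₁i hρ₁1 hρ₁s hρ₁mom hf hh)
    (fun f hf => metroScan_contraction_poly hε hS hρ₁0 hρ₁m hρ₁i hρ₁1 hρ₁s hρ₁mom hf)
    (fun f hf => polyObs_metroScan J lam hρ₂0 hρ₂m hρ₂mom hf)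
    (fun f h c hf hh x => metroScan_add_mul_poly J lam hρ₂0 hρ₂m hρ₂mom hf hh c x)
    (fun f h hf hh => metroScan_reversible_poly hε hS hρ₂0 hρ₂m hρ₂i hρ₂1 hρ₂s hρ₂mom hf hh)
    (fun f hf => metroScan_contraction_poly hε hS hρ₂0 hρ₂m hρ₂i hρ₂1 hρ₂s hρ₂mom hf)
    hc (fun v hv => metroScan_dirichlet_le_of_stepLaw_le hε hS hρ₁0 hρ₁m hρ₁i hρ₁1 hρ₁s hρ₁mom
      hρ₂0 hρ₂m hρ₂i hρ₂1 hρ₂s hρ₂mom hdom hv) hg hr0 hr1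

/-- **COMPARISON OF TWO STEP LAWS FOR `τ_int` (proposal units).**  Lattice φ⁴, coercive action
(every `λ > 0`, real `J`); even step densities `ρ₁ ≤ c ρ₂` with all moments (`c > 0`); `f ∈ PolyObs`
with `Var f > 0`, `g = f − ⟨f⟩`, normalised autocorrelation series summable under both scans.  Then
`τ_int,ρ₂(f) + ½ ≤ c · (τ_int,ρ₁(f) + ½)`. -/
theorem metropolisScan_tauInt_add_half_le_of_stepLaw_le {J : Fin (n + 1) → Fin (n + 1) → ℝ}
    {lam ε K : ℝ}
    (hε : 0 < ε) (hS : ∀ φ : Fin (n + 1) → ℝ, ε * ∑ w, φ w ^ 2 - K ≤ latticePhi4Action J lam φ)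
    {ρ₁ ρ₂ : ℝ → ℝ} (hρ₁0 : ∀ u, 0 ≤ ρ₁ u) (hρ₁m : Measurable ρ₁) (hρ₁i : Integrable ρ₁)
    (hρ₁1 : ∫ u, ρ₁ u = 1) (hρ₁s : ∀ u, ρ₁ (-u) = ρ₁ u)
    (hρ₁mom : ∀ j : ℕ, Integrable (fun u => (1 + |u|) ^ j * ρ₁ u))
    (hρ₂0 : ∀ u, 0 ≤ ρ₂ u) (hρ₂m : Measurable ρ₂) (hρ₂i : Integrable ρ₂)
    (hρ₂1 : ∫ u, ρ₂ u = 1) (hρ₂s : ∀ u, ρ₂ (-u) = ρ₂ u)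
    (hρ₂mom : ∀ j : ℕ, Integrable (fun u => (1 + |u|) ^ j * ρ₂ u))
    {c : ℝ} (hc : 0 < c) (hdom : ∀ u, ρ₁ u ≤ c * ρ₂ u)
    {f : (Fin (n + 1) → ℝ) → ℝ} (hf : PolyObs f)
    (hP : 0 < ∫ φ, (f φ - gibbsExpect J lam f) ^ 2 * gibbsWeight J lam φ)
    (hs₁ : Summable fun k => (∫ φ, (f φ - gibbsExpect J lam f)
        * ((metroScan J lam ρ₁)^[k + 1] (fun ψ => f ψ - gibbsExpect J lam f)) φ
        * gibbsWeight J lam φ)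
        / ∫ φ, (f φ - gibbsExpect J lam f) ^ 2 * gibbsWeight J lam φ)
    (hs₂ : Summable fun k => (∫ φ, (f φ - gibbsExpect J lam f)
        * ((metroScan J lam ρ₂)^[k + 1] (fun ψ => f ψ - gibbsExpect J lam f)) φ
        * gibbsWeight J lam φ)
        / ∫ φ, (f φ - gibbsExpect J lam f) ^ 2 * gibbsWeight J lam φ) :
    tauInt (fun k => (∫ φ, (f φ - gibbsExpect J lam f)
          * ((metroScan J lam ρ₂)^[k] (fun ψ => f ψ - gibbsExpect J lam f)) φ
          * gibbsWeight J lam φ)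
          / ∫ φ, (f φ - gibbsExpect J lam f) ^ 2 * gibbsWeight J lam φ) + 1 / 2
      ≤ c * (tauInt (fun k => (∫ φ, (f φ - gibbsExpect J lam f)
          * ((metroScan J lam ρ₁)^[k] (fun ψ => f ψ - gibbsExpect J lam f)) φ
          * gibbsWeight J lam φ)
          / ∫ φ, (f φ - gibbsExpect J lam f) ^ 2 * gibbsWeight J lam φ) + 1 / 2) := by
  have hg : PolyObs (fun ψ => f ψ - gibbsExpect J lam f) := polyObs_sub_const' hf _
  exact RevOp.tauInt_add_half_le_of_dirichlet_le_mul (μ := volume) (A := PolyObs)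
    (K := metroScan J lam ρ₁) (K' := metroScan J lam ρ₂) (w := gibbsWeight J lam)
    (fun φ => (gibbsWeight_pos J lam φ).le)
    (fun f h hf hh => polyObs_integrable_mul_mul_gibbsWeight hε hS hf hh)
    (fun f h c hf hh => polyObs_add_mul hf hh c)
    (fun f hf => polyObs_metroScan J lam hρ₁0 hρ₁m hρ₁mom hf)
    (fun f h c hf hh x => metroScan_add_mul_poly J lam hρ₁0 hρ₁m hρ₁mom hf hh c x)
    (fun f h hf hh => metroScan_reversible_poly hε hS hρ₁0 hρ₁m hρ₁i hρ₁1 hρ₁s hρ₁mom hf hh)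
    (fun f hf => metroScan_contraction_poly hε hS hρ₁0 hρ₁m hρ₁i hρ₁1 hρ₁s hρ₁mom hf)
    (fun f hf => polyObs_metroScan J lam hρ₂0 hρ₂m hρ₂mom hf)
    (fun f h c hf hh x => metroScan_add_mul_poly J lam hρ₂0 hρ₂m hρ₂mom hf hh c x)
    (fun f h hf hh => metroScan_reversible_poly hε hS hρ₂0 hρ₂m hρ₂i hρ₂1 hρ₂s hρ₂mom hf hh)
    hc (fun v hv => metroScan_dirichlet_le_of_stepLaw_le hε hS hρ₁0 hρ₁m hρ₁i hρ₁1 hρ₁s hρ₁mom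
      hρ₂0 hρ₂m hρ₂i hρ₂1 hρ₂s hρ₂mom hdom hv) hg hP hs₁ hs₂

end Lattice

end Summit.Ventures.LatticeQCDFlow.Exactness
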